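import Summits.NavierStokesRegularity.FluidComputer.PeriodicProfileAncientMild
import Literature.Analysis.FluidPDE.NSViscosityRescaling
import HarnessLib

/-!
# Unit-viscosity normalisation of an ancient DSS solution: the `rdssClass` hypotheses at `ν = 1`

Summit `NavierStokesRegularity`, cell topic directory `FluidComputer`, namespace
`…FluidComputer.SelfSimilarCensus`; zone Z7 of the D-0081 profile search. Companion of
`PeriodicProfileAncientMild.lean`, which shows that the exact periodic-profile object (classical on
whole slices of a terminal slab, bounded profile pressure, `1/|y|` tail) is the terminal piece of an
ancient classical AND mild `c`-DSS solution at the object's viscosity `ν > 0`. The kernel floors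
`rdssClass_*` are stated at viscosity `1`; Tao's dilation `v₁(s, x) = ν⁻¹ v(s/ν, x)`,
`q₁(s, x) = ν⁻² q(s/ν, x)` (`timeRescale ν⁻¹ ν⁻¹ v`, `timeRescale ν⁻¹ ν⁻² q`; tree
`IsClassicalNSSolutionOn.viscosityRescale_set`, PROVED) maps `(−∞, 0)` onto itself, commutes with the
parabolic scaling, and preserves the Type-I class — so the normalised field carries every structural
hypothesis of the floors AT `ν = 1`. PROVED theorems only; no definitions, no named facts.

## Content

* §1 (pure scaling) `isDiscretelySelfSimilar_timeRescale` (DSS commutes with time dilation),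
  `hasTypeIDecay_timeRescale` (`HasTypeIDecay C₀ v`, `a > 0` ⇒
  `HasTypeIDecay (a C₀ / min 1 √a) (timeRescale a a v)`), `isBoundedOn_Iic_timeRescale` (past-slab
  bounds survive dilation by `a > 0`).
* §2 **`unitViscosity_normalisation`** — an ancient classical `c`-DSS solution `(v, q)` at
  viscosity `ν > 0` with `HasTypeIDecay C₀ v`, pressure bounded on past slabs, measurable slices,
  non-trivial negative-time slices, normalises to `(v₁, q₁)` with the SAME list at viscosity `1`,
  including `IsAncientMildSolution 1 v₁` (Fabes–Jones–Rivière bridge of the tree again).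
* §3 **`periodicProfile_rdssClass_hypotheses_unitViscosity`** — for the periodic-profile object
  (hypotheses of `periodicProfile_exists_ancient_mild_dss`): `c > 1`, a field `v₁` equal to
  `x ↦ ν⁻¹ u(s/ν, x)` at every `s ∈ (ν θ(σ₂), 0)`, `σ₂ > σ₀`, with `IsAncientMildSolution 1 v₁`,
  measurable slices, `IsRotatedDSS c (LinearIsometryEquiv.refl ℝ E) v₁`, `HasTypeIDecay C₁ v₁`,
  `v₁(s) ≢ 0` for `s < 0` — literally the hypothesis list of `rdssClass_classicalRepresentative`.

WHAT THIS IS NOT: not an existence or non-existence claim, not Navier–Stokes evidence; «violates: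
none — no object».

References: T. Tao, Anal. PDE 6 (2013) = arXiv:1108.1165, footnote 3 [Tao2011]; G. Koch,
N. Nadirashvili, G. Seregin, V. Šverák, Acta Math. 203 (2009), §1 (1.3)–(1.6)
[KochNadirashviliSereginSverak2009]; E. B. Fabes, B. F. Jones, N. M. Rivière, ARMA 45 (1972),
Thm. 2.1 [FabesJonesRiviere1972].
-/

noncomputable section

open Set Filter Topology Function MeasureTheory
open scoped Laplacian RealInnerProductSpace

namespace Summit.NavierStokesRegularity.FluidComputer.SelfSimilarCensus

open Literature.Analysis.FluidPDE Literature.Analysis.FluidPDE.BradshawTsai2019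

/-! ### §1 Time dilation: DSS, Type I, past-slab bounds (pure scaling) -/

section Scaling

variable {E : Type*} [NormedAddCommGroup E] [NormedSpace ℝ E]
variable {F : Type*} [NormedAddCommGroup F] [NormedSpace ℝ F]

/-- **DSS commutes with time dilation**: if `nsRescale c v = v` then
`nsRescale c (timeRescale a κ v) = timeRescale a κ v` for all `a, κ` (the dilation
`(s, x) ↦ κ • v(a s, x)` acts on time by a scalar, the parabolic scaling by `c²`). [folklore] -/
theorem isDiscretelySelfSimilar_timeRescale {c a κ : ℝ} {v : ℝ → E → F}
    (h : IsDiscretelySelfSimilar c v) : IsDiscretelySelfSimilar c (timeRescale a κ v) := by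
  unfold IsDiscretelySelfSimilar at h ⊢
  funext s x
  have key := congrFun (congrFun h (a * s)) x
  rw [nsRescale_apply] at key
  rw [nsRescale_apply, timeRescale_apply, timeRescale_apply, ← key, smul_comm c κ,
    show a * (c ^ 2 * s) = c ^ 2 * (a * s) by ring]

omit [NormedSpace ℝ E] in
/-- **The Type-I class is preserved by time dilation** `(s, x) ↦ a • v(a s, x)`, `a > 0`:
`HasTypeIDecay C₀ v ⇒ HasTypeIDecay (a C₀ / min 1 √a) (timeRescale a a v)`
(`‖a v(as, x)‖ ≤ a C₀/(‖x‖ + √a √(−s))` and `‖x‖ + √a √(−s) ≥ min(1, √a)(‖x‖ + √(−s))`).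
[cite: KochNadirashviliSereginSverak2009, §1 (1.6)] -/
theorem hasTypeIDecay_timeRescale {C₀ a : ℝ} {v : ℝ → E → F} (h : HasTypeIDecay C₀ v)
    (ha : 0 < a) : HasTypeIDecay (a * C₀ / min 1 (Real.sqrt a)) (timeRescale a a v) := by
  have hC : 0 ≤ C₀ := by
    have h1 := h (-1) (by norm_num) 0
    rw [norm_zero, zero_add, neg_neg, Real.sqrt_one, div_one] at h1
    exact (norm_nonneg _).trans h1
  have hsa : 0 < Real.sqrt a := Real.sqrt_pos.2 ha
  have hm0 : 0 < min 1 (Real.sqrt a) := lt_min one_pos hsa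
  intro s hs x
  have has : a * s < 0 := mul_neg_of_pos_of_neg ha hs
  have hss : 0 < Real.sqrt (-s) := Real.sqrt_pos.2 (by linarith)
  have h1 := h (a * s) has x
  have hsq : Real.sqrt (-(a * s)) = Real.sqrt a * Real.sqrt (-s) := by
    rw [show -(a * s) = a * (-s) by ring, Real.sqrt_mul ha.le]
  rw [hsq] at h1
  have hden : 0 < ‖x‖ + Real.sqrt (-s) := by positivity
  have hcmp : min 1 (Real.sqrt a) * (‖x‖ + Real.sqrt (-s)) ≤ ‖x‖ + Real.sqrt a * Real.sqrt (-s) := by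
    have h2 : min 1 (Real.sqrt a) ≤ 1 := min_le_left _ _
    have h3 : min 1 (Real.sqrt a) ≤ Real.sqrt a := min_le_right _ _
    have h4 : 0 ≤ ‖x‖ := norm_nonneg _
    nlinarith [hss.le, hm0.le]
  rw [timeRescale_apply, norm_smul, Real.norm_of_nonneg ha.le]
  calc a * ‖v (a * s) x‖ ≤ a * (C₀ / (‖x‖ + Real.sqrt a * Real.sqrt (-s))) :=
        mul_le_mul_of_nonneg_left h1 ha.le
    _ ≤ a * (C₀ / (min 1 (Real.sqrt a) * (‖x‖ + Real.sqrt (-s)))) :=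
        mul_le_mul_of_nonneg_left (div_le_div_of_nonneg_left hC (by positivity) hcmp) ha.le
    _ = a * C₀ / min 1 (Real.sqrt a) / (‖x‖ + Real.sqrt (-s)) := by
        rw [div_div, mul_div_assoc]

omit [NormedAddCommGroup E] [NormedSpace ℝ E] in
/-- **Past-slab bounds survive time dilation** by `a > 0` (any amplitude `κ`): if `q` is bounded on
every `(−∞, t] × E`, `t < 0`, so is `timeRescale a κ q` (read `q` on `(−∞, a t]`). [folklore] -/
theorem isBoundedOn_Iic_timeRescale {q : ℝ → E → F} {a κ : ℝ}
    (hq : ∀ t < 0, IsBoundedOn (Iic t) q) (ha : 0 < a) {t : ℝ} (ht : t < 0) :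
    IsBoundedOn (Iic t) (timeRescale a κ q) := by
  obtain ⟨B, hB⟩ := hq (a * t) (mul_neg_of_pos_of_neg ha ht)
  refine ⟨‖κ‖ * B, fun s hs x => ?_⟩
  rw [timeRescale_apply, norm_smul]
  exact mul_le_mul_of_nonneg_left (hB (a * s) (mul_le_mul_of_nonneg_left hs ha.le) x)
    (norm_nonneg _)

end Scaling

/-! ### §2 Normalising an ancient classical DSS solution to unit viscosity -/

section Normalise

variable {E : Type*} [NormedAddCommGroup E] [InnerProductSpace ℝ E] [FiniteDimensional ℝ E]
  [MeasurableSpace E] [BorelSpace E]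

/-- **UNIT-VISCOSITY NORMALISATION.** Let `ν > 0` and let `(v, q)` be an ancient classical
solution of the unforced Navier–Stokes system with viscosity `ν` on `(−∞, 0)`,
`IsDiscretelySelfSimilar c v`, `HasTypeIDecay C₀ v`, `q` bounded on every past slab, all slices of
`v` a.e.-strongly measurable, `v(t) ≢ 0` for `t < 0`. Then `v₁ = timeRescale ν⁻¹ ν⁻¹ v`
(`v₁(s, x) = ν⁻¹ v(s/ν, x)`) and `q₁ = timeRescale ν⁻¹ ν⁻² q` satisfy:
`IsDiscretelySelfSimilar c v₁`; `IsClassicalNSSolutionOn (Iio 0) 1 0 v₁ q₁` (tree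
`IsClassicalNSSolutionOn.viscosityRescale_set`); **`IsAncientMildSolution 1 v₁`**;
`HasTypeIDecay (ν⁻¹ C₀ / min 1 √ν⁻¹) v₁`; `q₁` bounded on every past slab; measurable slices;
`v₁(s) ≢ 0` for `s < 0`. [cite: Tao2011, footnote 3] -/
theorem unitViscosity_normalisation {v : ℝ → E → E} {q : ℝ → E → ℝ} {c ν C₀ : ℝ} (hν : 0 < ν)
    (hv : IsDiscretelySelfSimilar c v) (hcl : IsClassicalNSSolutionOn (Iio 0) ν 0 v q)
    (hTI : HasTypeIDecay C₀ v) (hqb : ∀ t < 0, IsBoundedOn (Iic t) q)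
    (hmeas : ∀ t, AEStronglyMeasurable (v t) volume) (hne : ∀ t < 0, v t ≠ 0) :
    IsDiscretelySelfSimilar c (timeRescale ν⁻¹ ν⁻¹ v) ∧
      IsClassicalNSSolutionOn (Iio 0) 1 0 (timeRescale ν⁻¹ ν⁻¹ v) (timeRescale ν⁻¹ (ν⁻¹ ^ 2) q) ∧
      IsAncientMildSolution 1 (timeRescale ν⁻¹ ν⁻¹ v) ∧
      HasTypeIDecay (ν⁻¹ * C₀ / min 1 (Real.sqrt ν⁻¹)) (timeRescale ν⁻¹ ν⁻¹ v) ∧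
      (∀ t < 0, IsBoundedOn (Iic t) (timeRescale ν⁻¹ (ν⁻¹ ^ 2) q)) ∧
      (∀ t, AEStronglyMeasurable (timeRescale ν⁻¹ ν⁻¹ v t) volume) ∧
      ∀ t < 0, timeRescale ν⁻¹ ν⁻¹ v t ≠ 0 := by
  have hν' : 0 < ν⁻¹ := inv_pos.2 hν
  have hS' : MapsTo (fun s : ℝ => ν⁻¹ * s) (Iio 0) (Iio 0) := fun s hs => by
    simp only [mem_Iio] at hs ⊢
    exact mul_neg_of_pos_of_neg hν' hs
  have hcl₁ : IsClassicalNSSolutionOn (Iio 0) 1 0 (timeRescale ν⁻¹ ν⁻¹ v)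
      (timeRescale ν⁻¹ (ν⁻¹ ^ 2) q) := by
    have h := hcl.viscosityRescale_set hν.ne' hS' isOpen_Iio.uniqueDiffOn
    rwa [timeRescale_zero_force] at h
  have hTI₁ := hasTypeIDecay_timeRescale hTI hν'
  have hqb₁ : ∀ t < 0, IsBoundedOn (Iic t) (timeRescale ν⁻¹ (ν⁻¹ ^ 2) q) := fun t ht =>
    isBoundedOn_Iic_timeRescale hqb hν' ht
  refine ⟨isDiscretelySelfSimilar_timeRescale hv, hcl₁,
    hcl₁.isAncientMildSolution_of_hasTypeIDecay one_pos hTI₁ hqb₁, hTI₁, hqb₁, fun t => ?_,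
    fun t ht h0 => ?_⟩
  · rw [timeRescale_slice]
    exact (hmeas (ν⁻¹ * t)).const_smul ν⁻¹
  · refine hne (ν⁻¹ * t) (mul_neg_of_pos_of_neg hν' ht) (funext fun x => ?_)
    have h1 := congrFun h0 x
    rw [timeRescale_apply, Pi.zero_apply, smul_eq_zero] at h1
    exact h1.resolve_left hν'.ne'

end Normalise

/-! ### §3 The periodic-profile object at unit viscosity -/

section PeriodicProfile

variable {E : Type*} [NormedAddCommGroup E] [InnerProductSpace ℝ E] [FiniteDimensional ℝ E]
  [MeasurableSpace E] [BorelSpace E]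
variable {W : ℝ → E → E} {Q : ℝ → E → ℝ} {u : ℝ → E → E} {p : ℝ → E → ℝ}
  {ℓ ℓ' θ : ℝ → ℝ} {ν P σ₀ : ℝ}

/-! Standing hypotheses = those of `PeriodicProfileAncientMild` §3, verbatim. -/
variable (hP : 0 < P) (hℓ : ∀ σ, σ₀ < σ → HasDerivAt ℓ (ℓ' σ) σ) (hpos : ∀ σ, σ₀ < σ → 0 < ℓ σ)
  (hθ : ∀ σ, σ₀ < σ → HasDerivAt θ ((ℓ σ ^ 2)⁻¹) σ) (hW : ContDiff ℝ 1 (uncurry W))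
  (hper : ∀ s, W (s + P) = W s) (hperQ : ∀ s, Q (s + P) = Q s)
  (hW0 : ∀ σ, σ₀ < σ → W σ ≠ 0)
  (hans : ∀ σ, σ₀ < σ → ∀ x, u (θ σ) x = ℓ σ • W σ (ℓ σ • x))
  (hp : ∀ σ, σ₀ < σ → p (θ σ) = fun x => ℓ σ ^ 2 * Q σ (ℓ σ • x))
  (hu : ∀ σ, σ₀ < σ → ∀ x, DifferentiableAt ℝ (fun t => u t x) (θ σ))
  (heq : ∀ σ, σ₀ < σ → ∀ x : E,
    timeDeriv u (θ σ) x + convect (u (θ σ)) (u (θ σ)) x + gradient (p (θ σ)) x -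
      ν • (Δ (u (θ σ))) x = 0)
include hP hℓ hpos hθ hW hper hperQ hW0 hans hp hu heq

/-- **THE `rdssClass` HYPOTHESES AT UNIT VISCOSITY.** Under the hypotheses of
`periodicProfile_exists_ancient_mild_dss` (`θ → 0`, `ν > 0`, `(u, p)` classical on one terminal slab
`(θ(σ₁), 0) × E`, `|Q| ≤ B`, `‖W(σ, y)‖ ≤ K/(1 + ‖y‖)`) there are `c > 1`, a field `v₁` and a
constant `C₁` such that `v₁(s, ·) = ν⁻¹ u(s/ν, ·)` — the viscosity-normalised object — at every
`s ∈ (ν θ(σ₂), 0)`, `σ₂ > σ₀`, and `v₁` satisfies, BY NAME and AT VISCOSITY `1`, the hypothesis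
list of `rdssClass_classicalRepresentative` / the (K-a) floors: `IsAncientMildSolution 1 v₁`,
measurable slices, `IsRotatedDSS c (LinearIsometryEquiv.refl ℝ E) v₁`, `HasTypeIDecay C₁ v₁`,
`v₁(s) ≢ 0` for `s < 0`. [cite: KochNadirashviliSereginSverak2009, §1 (1.3)–(1.6)] -/
theorem periodicProfile_rdssClass_hypotheses_unitViscosity (hT : Tendsto θ atTop (𝓝 0))
    (hν : 0 < ν) {σ₁ : ℝ} (hσ₁ : σ₀ < σ₁) (hcl : IsClassicalNSSolutionOn (Ioo (θ σ₁) 0) ν 0 u p)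
    {B : ℝ} (hQb : ∀ σ, σ₀ < σ → ∀ y : E, |Q σ y| ≤ B)
    {K : ℝ} (hK : ∀ σ, σ₀ < σ → ∀ y : E, ‖W σ y‖ ≤ K / (1 + ‖y‖)) :
    ∃ c : ℝ, 1 < c ∧ ∃ (v₁ : ℝ → E → E) (C₁ : ℝ),
      (∀ σ₂, σ₀ < σ₂ → ∀ s ∈ Ioo (ν * θ σ₂) 0, v₁ s = fun x => ν⁻¹ • u (ν⁻¹ * s) x) ∧
      IsAncientMildSolution 1 v₁ ∧ (∀ s < 0, AEStronglyMeasurable (v₁ s) volume) ∧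
      IsRotatedDSS c (LinearIsometryEquiv.refl ℝ E) v₁ ∧ HasTypeIDecay C₁ v₁ ∧
      ∀ s < 0, v₁ s ≠ 0 := by
  obtain ⟨c, hc, v, q, hv, -, hvu, -, hvcl, -, ⟨C₀, hTI⟩, hqb, hmeas, -, hne⟩ :=
    periodicProfile_exists_ancient_mild_dss hP hℓ hpos hθ hW hper hperQ hW0 hans hp hu heq hT hν
      hσ₁ hcl hQb hK
  obtain ⟨hv₁, -, hmild₁, hTI₁, -, hmeas₁, hne₁⟩ :=
    unitViscosity_normalisation hν hv hvcl hTI hqb hmeas hne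
  have hν' : 0 < ν⁻¹ := inv_pos.2 hν
  refine ⟨c, hc, timeRescale ν⁻¹ ν⁻¹ v, _, fun σ₂ hσ₂ s hs => ?_, hmild₁, fun s _ => hmeas₁ s,
    isRotatedDSS_refl_iff.2 hv₁, hTI₁, hne₁⟩
  have hs' : ν⁻¹ * s ∈ Ioo (θ σ₂) 0 := by
    refine ⟨?_, mul_neg_of_pos_of_neg hν' hs.2⟩
    have h1 := mul_lt_mul_of_pos_left hs.1 hν'
    rwa [← mul_assoc, inv_mul_cancel₀ hν.ne', one_mul] at h1
  rw [timeRescale_slice, hvu σ₂ hσ₂ _ hs']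

end PeriodicProfile

end Summit.NavierStokesRegularity.FluidComputer.SelfSimilarCensus

end
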